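import Summits.QuantumAdvantage.QuantumAdvantage.Theorems.LengthDialA

/-!
# LengthDial, part B/7 (§3–§4: the PEEL LAW (`ringWinU_peel1/peel2`, `winCount_peel`) and the `𝔽_p`-degree bookkeeping (peeled cut degree `≤ 5D`)) — support for item stmt-QuantumAdvantage-28401 (`Theses.AbsorptionDial.MassHiQuasi`)

Cell decomp-qadv, seat lens-5 («finite range + asymptotic regime + bridge»), generation 26 — land port of the node
«LengthDial» (published under the cell's HOME/decomp-qadv-lens-5/g26/LengthDial.lean, record NODE-g26.md; RESIDUAL MODE on
AbsorptionDial:28401 `MassHiQuasi`).  The node file with ONLY the namespace renamed `Theses.LengthDial → Theorems.LengthDial`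
and split at section boundaries into parts A–G (each importing the previous; part G alone imports the route file
Theses.AbsorptionDial for the BY-NAME equivalences and `closes`).  Prop-defs = the node's hardness predicates / grades only.
Tree facts reused by name, not restated: `RigidityLaws.walkExp_zero/self`, `RigidityLaws.ringWinU_congr_mod`,
`RigidityLaws.threeCharge`, `RigidityLaws.hasDegF_xor`, `FibreDial.const_of_hasDegF_zero`, `WalkCoreBasics.ringWinU_compl`, `chargeRecursion`, `sliceAt_mem_lowDeg`,
`Smolensky.comp_mem_lowDeg_of_coord`.  No `sorry`, no new axioms, no instances, no notation.
-/

set_option autoImplicit false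
set_option linter.unusedVariables false
set_option linter.dupNamespace false
set_option linter.style.longLine false

namespace Summit.QuantumAdvantage.QuantumAdvantage.Theorems.LengthDial

open Finset
open Summit.QuantumAdvantage.AdviceFreeQNC0
open Literature.Computability.MetaComplexity Literature.Computability.MetaComplexity.Smolensky

/-! ## §3 The peel law -/

section Peel
variable {n : ℕ}

/-- the strategy on the face `u₀ = b`: cut `h` of the `n`-game is cut `h+1` of `y`. -/
def tailStrat (b : Bool) (y : Fin (n + 2) → (Fin (n + 1) → Bool) → Bool) :
    Fin (n + 1) → (Fin n → Bool) → Bool :=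
  fun h v => y h.succ (Fin.cons b v)

/-- cut `0` of `y` on the face `u₀ = b` (the extra term). -/
def headFn (b : Bool) (y : Fin (n + 2) → (Fin (n + 1) → Bool) → Bool) : (Fin n → Bool) → Bool :=
  fun v => y 0 (Fin.cons b v)

/-- the charge after one peel. -/
def c1 (c : ℕ) (b : Bool) : ℕ := c + 1 + 2 * b.toNat

/-- the peeled strategy on a GOOD face (one merge). -/
def peel1 (c : ℕ) (b : Bool) (y : Fin (n + 2) → (Fin (n + 1) → Bool) → Bool) :
    Fin (n + 1) → (Fin n → Bool) → Bool :=
  merge (c + b.toNat) (c1 c b) (headFn b y) (tailStrat b y)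

/-- **GOOD FACE**: if the peeled game `(n, c+1+2b)` is off-diagonal, the face `u₀ = b` of the
`(n+1)`-game IS the `n`-game played by `peel1`. -/
theorem ringWinU_peel1 (c : ℕ) (b : Bool) (y : Fin (n + 2) → (Fin (n + 1) → Bool) → Bool)
    (hgood : c1 c b % 3 ≠ n % 3) (u' : Fin n → Bool) :
    ringWinU c y (Fin.cons b u') = ringWinU (c1 c b) (peel1 c b y) u' := by
  rw [peel1, ringWinU_merge _ _ hgood, chargeRecursion n c y b u']
  rfl

/-- the charge after two peels. -/
def c2 (c : ℕ) (b b' : Bool) : ℕ := c1 (c1 c b) b'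

/-- after a DIAGONAL first peel the second peel is always off-diagonal. -/
theorem c2_offDiag (c k : ℕ) (b b' : Bool) (hbad : c1 c b % 3 = (k + 1) % 3) :
    c2 c b b' % 3 ≠ k % 3 := by
  unfold c2 at *
  unfold c1 at *
  cases b' <;> (simp [Bool.toNat] at *; omega)

variable {k : ℕ}

/-- the peeled strategy on a BAD face, sub-face `u₁ = b'` (two merges). -/
def peel2 (c : ℕ) (b b' : Bool) (y : Fin (k + 3) → (Fin (k + 2) → Bool) → Bool) :
    Fin (k + 1) → (Fin k → Bool) → Bool :=
  merge (c + b.toNat + b'.toNat) (c2 c b b') (fun v => y 0 (Fin.cons b (Fin.cons b' v)))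
    (merge (c1 c b + b'.toNat) (c2 c b b') (headFn b' (tailStrat b y)) (tailStrat b' (tailStrat b y)))

/-- **BAD FACE**: if the first peel is diagonal, the sub-face `u₀ = b, u₁ = b'` of the `(k+2)`-game IS
the `k`-game `(k, c2)` played by `peel2`. -/
theorem ringWinU_peel2 (c : ℕ) (b b' : Bool) (y : Fin (k + 3) → (Fin (k + 2) → Bool) → Bool)
    (hbad : c1 c b % 3 = (k + 1) % 3) (u'' : Fin k → Bool) :
    ringWinU c y (Fin.cons b (Fin.cons b' u'')) = ringWinU (c2 c b b') (peel2 c b b' y) u'' := by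
  have hoff := c2_offDiag c k b b' hbad
  rw [peel2, ringWinU_merge _ _ hoff, ringWinU_merge _ _ hoff, chargeRecursion (k + 1) c y b (Fin.cons b' u'')]
  have h2 := chargeRecursion k (c1 c b) (tailStrat b y) b' u''
  have e : (c + b.toNat + wt (Fin.cons b' u'' : Fin (k + 1) → Bool)) = c + b.toNat + b'.toNat + wt u'' := by
    rw [wt_cons]; ring
  rw [e]
  unfold c1 at h2 ⊢
  unfold c2 c1 tailStrat headFn at *
  rw [h2]

/-! ### Win counts split over the first bit -/

/-- `Bool × (Fin n → Bool) ≃ (Fin (n+1) → Bool)` by `cons`. -/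
def consEquiv (n : ℕ) : Bool × (Fin n → Bool) ≃ (Fin (n + 1) → Bool) where
  toFun q := Fin.cons q.1 q.2
  invFun u := (u 0, Fin.tail u)
  left_inv q := by
    obtain ⟨a, f⟩ := q
    simp only [Fin.cons_zero, Fin.tail_cons]
  right_inv u := Fin.cons_self_tail u

/-- counting over `Fin (n+1) → Bool` by the first bit (`Fin.cons`). -/
theorem card_filter_cons (P : (Fin (n + 1) → Bool) → Prop) [DecidablePred P] :
    (univ.filter P).card = ∑ b : Bool, (univ.filter fun u' : Fin n → Bool => P (Fin.cons b u')).card := by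
  have h1 : (univ.filter P).card
      = (univ.filter fun q : Bool × (Fin n → Bool) => P (Fin.cons q.1 q.2)).card := by
    rw [← Fintype.card_subtype, ← Fintype.card_subtype]
    refine Fintype.card_congr (Equiv.subtypeEquiv (consEquiv n).symm fun u => ?_)
    show P u ↔ P (Fin.cons (u 0) (Fin.tail u))
    rw [Fin.cons_self_tail]
  rw [h1, Finset.card_filter, Fintype.sum_prod_type]
  simp only [Finset.card_filter]

/-- number of won inputs of the game `(m, c)` played by `y`. -/
def winCount (m c : ℕ) (y : Fin (m + 1) → (Fin m → Bool) → Bool) : ℕ :=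
  (univ.filter fun u : Fin m → Bool => ringWinU c y u = true).card

/-- trivial bound `#win ≤ 2^m`. -/
theorem winCount_le (m c : ℕ) (y : Fin (m + 1) → (Fin m → Bool) → Bool) : winCount m c y ≤ 2 ^ m := by
  unfold winCount
  calc (univ.filter fun u : Fin m → Bool => ringWinU c y u = true).card
      ≤ (univ : Finset (Fin m → Bool)).card := Finset.card_filter_le _ _
    _ = 2 ^ m := by simp

/-- win count at length `n+1` = sum over the first bit of the face counts. -/
theorem winCount_cons (c : ℕ) (y : Fin (n + 2) → (Fin (n + 1) → Bool) → Bool) :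
    winCount (n + 1) c y
      = ∑ b : Bool, (univ.filter fun u' : Fin n → Bool => ringWinU c y (Fin.cons b u') = true).card := by
  unfold winCount
  rw [card_filter_cons]

/-- GOOD face: the face count is the win count of the once-peeled strategy. -/
theorem winCount_face_good (c : ℕ) (b : Bool) (y : Fin (n + 2) → (Fin (n + 1) → Bool) → Bool)
    (hgood : c1 c b % 3 ≠ n % 3) :
    (univ.filter fun u' : Fin n → Bool => ringWinU c y (Fin.cons b u') = true).card
      = winCount n (c1 c b) (peel1 c b y) := by
  unfold winCount
  congr 1
  ext u'
  simp only [mem_filter, mem_univ, true_and, ringWinU_peel1 c b y hgood]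

/-- BAD face: the face count is the sum over the second bit of the twice-peeled win counts. -/
theorem winCount_face_bad (c : ℕ) (b : Bool) (y : Fin (k + 3) → (Fin (k + 2) → Bool) → Bool)
    (hbad : c1 c b % 3 = (k + 1) % 3) :
    (univ.filter fun u' : Fin (k + 1) → Bool => ringWinU c y (Fin.cons b u') = true).card
      = ∑ b' : Bool, winCount k (c2 c b b') (peel2 c b b' y) := by
  rw [card_filter_cons]
  unfold winCount
  refine Finset.sum_congr rfl fun b' _ => ?_
  congr 1
  ext u''
  simp only [mem_filter, mem_univ, true_and, ringWinU_peel2 c b b' y hbad]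

/-- **THE PEEL IDENTITY FOR WIN COUNTS** (class-free): the wins of `y` at length `k+2` are the wins
of the peeled strategies in OFF-DIAGONAL games of lengths `k+1` (good faces) and `k` (bad faces). -/
theorem winCount_peel (c : ℕ) (y : Fin (k + 3) → (Fin (k + 2) → Bool) → Bool) :
    winCount (k + 2) c y = ∑ b : Bool,
      (if c1 c b % 3 ≠ (k + 1) % 3 then winCount (k + 1) (c1 c b) (peel1 c b y)
       else ∑ b' : Bool, winCount k (c2 c b b') (peel2 c b b' y)) := by
  rw [winCount_cons]
  refine Finset.sum_congr rfl fun b _ => ?_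
  split_ifs with h
  · exact winCount_face_good c b y h
  · push Not at h
    exact winCount_face_bad c b y h

end Peel


/-! ## §4 Degree bookkeeping over `𝔽_p` -/

section Degree
variable {p : ℕ} [Fact p.Prime] {n : ℕ}

/-- `HasDegF` is monotone in the degree. -/
theorem hasDegF_mono {D D' : ℕ} {f : (Fin n → Bool) → Bool} (hf : HasDegF p f D) (h : D ≤ D') :
    HasDegF p f D' :=
  lowDeg_mono h hf

/-- restriction to a face is free. -/
theorem hasDegF_cons {D : ℕ} (b : Bool) {f : (Fin (n + 1) → Bool) → Bool} (hf : HasDegF p f D) :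
    HasDegF p (fun v : Fin n → Bool => f (Fin.cons b v)) D := by
  unfold HasDegF at *
  exact sliceAt_mem_lowDeg (F := ZMod p) b hf

/-- the constant-`false` function has every degree. -/
theorem hasDegF_falseFn (D : ℕ) : HasDegF p (fun _ : Fin n → Bool => false) D := by
  unfold HasDegF
  have h : (fun x : Fin n → Bool => if false = true then (1 : ZMod p) else 0) = 0 := by
    funext x; simp
  rw [h]
  exact Submodule.zero_mem _

/-- `α ∧ e` has the degree of `e` (constant `α`). -/
theorem hasDegF_constAnd {D : ℕ} (α : Bool) {e : (Fin n → Bool) → Bool} (he : HasDegF p e D) :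
    HasDegF p (fun u => α && e u) D := by
  cases α
  · simp only [Bool.false_and]
    exact hasDegF_falseFn D
  · simp only [Bool.true_and]
    exact he

variable {m : ℕ}

/-- degree of a merged cut: `≤ D + E + E` (original cut `D`, absorbed term `E`). -/
theorem hasDegF_merge {D E : ℕ} (r c : ℕ) {e : (Fin m → Bool) → Bool}
    {z : Fin (m + 1) → (Fin m → Bool) → Bool} (he : HasDegF p e E) (hz : ∀ g, HasDegF p (z g) D)
    (g : Fin (m + 1)) : HasDegF p (merge r c e z g) (D + E + E) := by
  unfold merge
  exact RigidityLaws.hasDegF_xor (RigidityLaws.hasDegF_xor (hz g) (hasDegF_constAnd _ he)) (hasDegF_constAnd _ he)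

/-- restricting a strategy to a face does not raise the degree. -/
theorem hasDegF_tailStrat {D : ℕ} (b : Bool) {y : Fin (n + 2) → (Fin (n + 1) → Bool) → Bool}
    (hy : ∀ g, HasDegF p (y g) D) (h : Fin (n + 1)) : HasDegF p (tailStrat b y h) D :=
  hasDegF_cons b (hy h.succ)

/-- the restricted head cut keeps its degree. -/
theorem hasDegF_headFn {D : ℕ} (b : Bool) {y : Fin (n + 2) → (Fin (n + 1) → Bool) → Bool}
    (hy : ∀ g, HasDegF p (y g) D) : HasDegF p (headFn b y) D :=
  hasDegF_cons b (hy 0)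

/-- peeled strategies (good face) have cut degree `≤ 3D ≤ 5D`. -/
theorem hasDegF_peel1 {D : ℕ} (c : ℕ) (b : Bool) {y : Fin (n + 2) → (Fin (n + 1) → Bool) → Bool}
    (hy : ∀ g, HasDegF p (y g) D) (g : Fin (n + 1)) : HasDegF p (peel1 c b y g) (5 * D) := by
  have h := hasDegF_merge (c + b.toNat) (c1 c b) (hasDegF_headFn b hy) (hasDegF_tailStrat b hy) g
  exact hasDegF_mono h (by omega)

variable {k : ℕ}

/-- peeled strategies (bad face) have cut degree `≤ 5D`. -/
theorem hasDegF_peel2 {D : ℕ} (c : ℕ) (b b' : Bool) {y : Fin (k + 3) → (Fin (k + 2) → Bool) → Bool}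
    (hy : ∀ g, HasDegF p (y g) D) (g : Fin (k + 1)) : HasDegF p (peel2 c b b' y g) (5 * D) := by
  have hy' : ∀ h, HasDegF p (tailStrat b y h) D := hasDegF_tailStrat b hy
  have h0 : HasDegF p (fun v : Fin k → Bool => y 0 (Fin.cons b (Fin.cons b' v))) D :=
    hasDegF_cons b' (hasDegF_cons b (hy 0))
  have hin : ∀ g, HasDegF p (merge (c1 c b + b'.toNat) (c2 c b b') (headFn b' (tailStrat b y))
      (tailStrat b' (tailStrat b y)) g) (D + D + D) :=
    hasDegF_merge _ _ (hasDegF_headFn b' hy') (hasDegF_tailStrat b' hy')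
  have h := hasDegF_merge (c + b.toNat + b'.toNat) (c2 c b b') h0 hin g
  exact hasDegF_mono h (by omega)

end Degree

end Summit.QuantumAdvantage.QuantumAdvantage.Theorems.LengthDial
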